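/-
Copyright (c) 2026 the pub-hodgecm-mathlib formalisation cell (harness21).  Prover seat hodgecm-mathlib-K2E4-p11 (g7), Track B ∕ K2-LIT, h413 = `stmt-HodgeConjecture-24833`,
ENGINE E1, 5Res campaign «ENDGAME BY FAMILIES», AMENDMENT #3 «GENERAL (U,τ) LADDER» rung G11, deal (282) of K2E1-plan (g7): the `K_∞`-TYPE (scalar `τ`) EDITION of K2E4-p23's ★
`K2E1ResidualSphericalFiniteOfTwoBlockFamilies` §3 — «the `K′_f`-invariant, `τ`-isotypic part of `L²_res(U(J)_{L∕L⁺}, 𝔓)` is finite-dimensional» modulo `hEis_τ` over the two block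
families and the per-block model letters of each family; with the in-file WITNESS at `τ = 1` re-deriving p23's head verbatim.
-/
import Summits.HodgeConjecture.HodgeConjecture.Theorems.K2E1ResidualKTypeAtomLettersCMTwo   -- ★ part 1 (this seat): generic `τ`-top, `hPfix_kType`, `hEisdef_kType_split`, `hD5_letterFree_two_of_letters`, bridges; brings ★ p23 `hEXH₂`∕`hatoms_of_noLineMass₂`, ★ `hPEis_of_letters`
import HarnessLib

/-!
# K2·E1 — `K2E1ResidualKTypeFiniteOfTwoBlockFamilies`: RUNG 1 AT A SCALAR `K_∞`-TYPE `τ`, TWO BLOCK FAMILIES — «`(L²_res(U(J)_{L∕L⁺}, 𝔓))^{K′_f, τ}` IS FINITE-DIMENSIONAL»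
# modulo `hEis_τ` and the per-block model letters (G11 skeleton τ-edition of ★ `residual_invariants_finiteDimensional_letterFree_of_twoBlockFamilies`, deal (282), part 2 of 2)

Track B ∕ K2-LIT, crux h413 = `stmt-HodgeConjecture-24833`, route of record `HCCMUnconditional`; cell `hodgecm-mathlib`, squad K2, ENGINE E1 (5Res, AMENDMENT #3 G11); dealer
K2E1-plan (g7) (282).  THEOREMS ONLY (no `def`, no `instance`, no notation, no named-fact hypothesis, no `sorry`; default heartbeats except the MEASURED scoped `set_option maxHeartbeats 400000 in` lines marked R36); lane `--supports stmt-HodgeConjecture-24833 --as helper`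
(count-neutral).  CLOSES NO SOCKET.

SETTING (K2E2-p12's frame, as ★ p23): `G = U(J)` over the CM extension `L∕L⁺`, `N = 2`, `c(J) = J`, `J² = 1`, `J ↦ (0 1; 1 0)` at the complex places; `K_∞ := U(J)(L⁺ ⊗ ℝ) ∩ U(1 ⊗ 1)`
(`ι_∞ ∘ incl`), probability Haar measure `μ_K`; an open level `K′ ≤ G(𝔸_f)` with normalised idempotent `e`; the SCALAR `K_∞`-TYPE `τ : K_∞ →* ℂ`, `‖τ‖ = 1` (`hτ`), projector test
function `χ = τ⁻¹` (`hχτ : χ k = (τ k)⁻¹`), block projector `P = P_χ ∘L R_f(e)` (`hPdef`, p23's bytes); two block families (off-dual: any `S₁`, no atoms; self-dual: `[Finite S₂]`,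
finite-dimensional atoms) with p23's per-block model letters VERBATIM (`gen V hV Jb h hhl hhr s hs hU hline` ×2).  `τ`-ISOTYPIC EISENSTEIN SPACE (dealer's split currency):
`Eis_τ := (L²_cusp(𝔓))ᗮ ⊓ (R ∘ ι_f|_{K′})-invariants ⊓ ⨅_{k : K_∞} eigenspace (R (ι_∞ incl k)) (τ k)`; the letter `hEis : Eis_τ ≤ closure ((⨆ closure span gen₁ b) ⊔ (⨆ closure span gen₂ b))`
is C7″∕NAMED_τ's output (K2E1-p12 ∕ K2E1-p10); the `(Kad, ω)`-isotypic currency of ★ G10∕HEAD_τ is one closure induction away (★ p860928 `apply_eq_smul_of_mem_closure`).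
PLUGGED ★ BY NAME: `hPfix` (★ `hPfix_kType` ⟸ p860649), `hEXH` (★ p23 `hEXH₂`), `hPEis` (★ p860688 `hPEis_of_letters` ∘ ★ `hEisdef_kType_split` ⟸ p860843), `hD5` (★ `hD5_letterFree_two_of_letters`
⟸ p860686, per family), glue (★ p23 `hatoms_of_noLineMass₂` at `χ₀ := τ`), top (★ `residual_kType_finiteDimensional_of_atoms`, `L²` currency).
* §1 **`hatoms_kType_letterFree_of_twoBlockFamilies`** — the `hatoms` clause at `(τ, K′)` from the two families (p23's ★ `hatoms_trivialKType_letterFree_of_twoBlockFamilies` at `τ`).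
* §1 HEAD **`residual_kType_finiteDimensional_letterFree_of_twoBlockFamilies`** — `FiniteDimensional ℂ (L²_res(𝔓) ⊓ (R∘ι_f|_{K′})-invariants ⊓ ⨅_k eigenspace (R (ι_∞ incl k)) (τ k))`.
* §2 WITNESS (non-vacuity, mandatory since (279) R3): an in-file `example` whose statement is p23's ★ head VERBATIM (general `Kad ∕ hKad`, `hχ1`), proved from the `τ`-head
  at `τ = 1` (★ `eisOne_split_le_eis`, ★ `invariants_le_iInf_eigenspace_one`) — an `example`, not a theorem, because the gate's `dedup.landed` forbids re-declaring a landed statement.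
HONEST LABEL: HC_CM is proved only modulo the 7 printed citations (2 remaining named inputs: hLiu418 = `stmt-HodgeConjecture-24832`, h413 = `stmt-HodgeConjecture-24833`) until rung 0
closes; this file asserts no named fact, is conditional by construction on its visible binders, and closes no socket; count-neutral; RUNG 1_τ ≠ 5Res.

## References
* [MoeglinWaldspurger1995] C. Mœglin, J.-L. Waldspurger, *Spectral decomposition and Eisenstein series* (1995), I.2.18, II.2.4, IV.3.12, V.3.13, VI.2.
* [HarishChandra1968] Harish-Chandra, *Automorphic forms on semisimple Lie groups*, LNM 62 (1968), Thm. 1.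
* [BorelJacquet1979] A. Borel, H. Jacquet, PSPM 33.1 (1979), §4.1, §4.6.
* [Knapp1986] A. W. Knapp, *Representation Theory of Semisimple Groups* (1986), VIII §3.
-/

set_option autoImplicit false
-- the mandated namespace repeats the single-problem summit's segment (`HodgeConjecture.HodgeConjecture`)
set_option linter.dupNamespace false

noncomputable section

open MeasureTheory MeasureTheory.Measure Filter Topology CompactlySupported NumberField NumberField.mixedEmbedding NumberField.InfinitePlace ContRepresentation Set
open scoped InnerProductSpace ENNReal ComplexConjugate NNReal
open Literature.NumberTheory.Automorphic Literature.NumberTheory.Automorphic.UnitaryGroup AdelicGroupData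
open Summit.HodgeConjecture.HodgeConjecture.Cruxes.H413.K2E1CuspidalSpectrumUnitary
open Summit.HodgeConjecture.HodgeConjecture.Cruxes.H413.K2E1ResidualPartInAtomsCMTwo (hPEis_of_letters)
open Summit.HodgeConjecture.HodgeConjecture.Cruxes.H413.K2E1ResidualSphericalFiniteOfTwoBlockFamilies (hEXH₂ hatoms_of_noLineMass₂)
open Summit.HodgeConjecture.HodgeConjecture.Cruxes.H413.K2E1ResidualKTypeAtomLettersCMTwo

namespace Summit.HodgeConjecture.HodgeConjecture.Cruxes.H413.K2E1ResidualKTypeFiniteOfTwoBlockFamilies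

/-! ## §1 `U(J)(𝔸_{L⁺})`: the `hatoms` clause at `(τ, K′)` and RUNG 1_τ for two block families -/

section CM

variable {L : Type} [Field L] [NumberField L] [IsCMField L] (J : Matrix (Fin 2) (Fin 2) L)
  (μ : Measure (cmDatum L 2 J).automorphicQuotient) [(cmDatum L 2 J).IsAutomorphicMeasure μ]
  [MeasurableSpace (UnitaryGroup.arch (↥(maximalRealSubfield L)) L (IsCMField.complexConj L) 2 J)] [BorelSpace (UnitaryGroup.arch (↥(maximalRealSubfield L)) L (IsCMField.complexConj L) 2 J)]
  [MeasurableSpace (finAdelic (↥(maximalRealSubfield L)) L (IsCMField.complexConj L) 2 J)] [BorelSpace (finAdelic (↥(maximalRealSubfield L)) L (IsCMField.complexConj L) 2 J)]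
  (νinf : Measure (UnitaryGroup.arch (↥(maximalRealSubfield L)) L (IsCMField.complexConj L) 2 J)) [IsHaarMeasure νinf] [νinf.IsInvInvariant] [SFinite νinf]
  (νf : Measure (finAdelic (↥(maximalRealSubfield L)) L (IsCMField.complexConj L) 2 J)) [IsFiniteMeasureOnCompacts νf] [νf.IsMulLeftInvariant] [νf.IsInvInvariant] [νf.IsOpenPosMeasure]
  [MeasurableSpace ↥(UnitaryGroup.arch (↥(maximalRealSubfield L)) L (IsCMField.complexConj L) 2 J ⊓ unitaryGroupOfForm (conjMixed (↥(maximalRealSubfield L)) L (IsCMField.complexConj L)) 1)] [BorelSpace ↥(UnitaryGroup.arch (↥(maximalRealSubfield L)) L (IsCMField.complexConj L) 2 J ⊓ unitaryGroupOfForm (conjMixed (↥(maximalRealSubfield L)) L (IsCMField.complexConj L)) 1)]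
  (μK : Measure ↥(UnitaryGroup.arch (↥(maximalRealSubfield L)) L (IsCMField.complexConj L) 2 J ⊓ unitaryGroupOfForm (conjMixed (↥(maximalRealSubfield L)) L (IsCMField.complexConj L)) 1)) [IsProbabilityMeasure μK] [μK.IsMulLeftInvariant] [μK.IsMulRightInvariant] [μK.IsInvInvariant]
  (χ : C_c(↥(UnitaryGroup.arch (↥(maximalRealSubfield L)) L (IsCMField.complexConj L) 2 J ⊓ unitaryGroupOfForm (conjMixed (↥(maximalRealSubfield L)) L (IsCMField.complexConj L)) 1), ℂ)) (e : C_c(finAdelic (↥(maximalRealSubfield L)) L (IsCMField.complexConj L) 2 J, ℂ))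


set_option maxHeartbeats 400000 in -- measured (R36): farm-direct cost of this decl ∈ (150000, 200000] at the default 200000 (probes 150000 ✗ ∕ 200000 ✓) = lake-cliff class (BF-N26∕N27); scoped 400000 = 2×
/-- **`hatoms` AT `(τ, K′)` FROM TWO BLOCK FAMILIES** (p23's ★ `hatoms_trivialKType_letterFree_of_twoBlockFamilies` at a scalar `K_∞`-type): ★ `hatoms_of_noLineMass₂` at `χ₀ := τ` fed by
★ `hPfix_kType`, ★ `hEXH₂`, ★ `hPEis_of_letters` ∘ ★ `hEisdef_kType_split` (so `Eis := Eis_τ`, split currency), and ★ `hD5_letterFree_two_of_letters` per family.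
[cite: MoeglinWaldspurger1995, I.2.18, V.3.13] [cite: BorelJacquet1979, §4.6] -/
theorem hatoms_kType_letterFree_of_twoBlockFamilies [MeasurableMul (finAdelic (↥(maximalRealSubfield L)) L (IsCMField.complexConj L) 2 J)] [ENNReal.HolderTriple ∞ 2 2]
    (hJc : J.map (IsCMField.complexConj L : L → L) = J) (hJ2 : J * J = 1)
    (hJw : ∀ w : {w : InfinitePlace L // IsComplex w}, J.map w.1.embedding = !![(0 : ℂ), 1; 1, 0])
    (τ : ↥(UnitaryGroup.arch (↥(maximalRealSubfield L)) L (IsCMField.complexConj L) 2 J ⊓ unitaryGroupOfForm (conjMixed (↥(maximalRealSubfield L)) L (IsCMField.complexConj L)) 1) →* ℂ) (hχτ : ∀ k, χ k = (τ k)⁻¹) (hτ : ∀ k, ‖τ k‖ = 1)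
    (K' : Subgroup (finAdelic (↥(maximalRealSubfield L)) L (IsCMField.complexConj L) 2 J)) (hK'o : IsOpen (K' : Set (finAdelic (↥(maximalRealSubfield L)) L (IsCMField.complexConj L) 2 J))) (he0 : ∀ x, x ∉ K' → e x = 0) (he1 : ∫ x, e x ∂νf = 1)
    (heK : ∀ k ∈ K', ∀ x, e (k * x) = e x) (hestar : ∀ x, mulStar (⇑e) x = e x)
    (P : (cmDatum L 2 J).L2 μ →L[ℂ] (cmDatum L 2 J).L2 μ) (hPdef : P = ((((cmDatum L 2 J).rightRegular μ).restrict ((archToAdelic (↥(maximalRealSubfield L)) L (IsCMField.complexConj L) 2 J).comp (Subgroup.inclusion (inf_le_left : UnitaryGroup.arch (↥(maximalRealSubfield L)) L (IsCMField.complexConj L) 2 J ⊓ unitaryGroupOfForm (conjMixed (↥(maximalRealSubfield L)) L (IsCMField.complexConj L)) 1 ≤ UnitaryGroup.arch (↥(maximalRealSubfield L)) L (IsCMField.complexConj L) 2 J)))).integratedOperator (((cmDatum L 2 J).isUnitary_rightRegular μ).restrict _)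
          (((cmDatum L 2 J).isStronglyContinuous_rightRegular_holds μ).restrict _ ((continuous_archToAdelic (↥(maximalRealSubfield L)) L (IsCMField.complexConj L) 2 J).comp (continuous_induced_rng.2 continuous_subtype_val))) μK χ ∘L
        (((cmDatum L 2 J).rightRegular μ).restrict (finAdelicToAdelic (↥(maximalRealSubfield L)) L (IsCMField.complexConj L) 2 J)).integratedOperator (((cmDatum L 2 J).isUnitary_rightRegular μ).restrict _) (((cmDatum L 2 J).isStronglyContinuous_rightRegular_holds μ).restrict _ (continuous_finAdelicToAdelic (↥(maximalRealSubfield L)) L (IsCMField.complexConj L) 2 J)) νf e))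
    (𝔓 : (cmDatum L 2 J).ParabolicUnipotentData)
    {S₁ : Type*} (gen₁ : S₁ → Set ((cmDatum L 2 J).L2 μ))
    {A₁ : S₁ → Type*} [∀ b, AddCommGroup (A₁ b)] [∀ b, Module ℂ (A₁ b)] [∀ b, Subsingleton (A₁ b)]
    {Ω₁ : S₁ → Type*} {mΩ₁ : ∀ b, MeasurableSpace (Ω₁ b)} (m₁ : ∀ b, Measure (Ω₁ b)) {E₁ : S₁ → Type*} [∀ b, NormedAddCommGroup (E₁ b)] [∀ b, NormedSpace ℂ (E₁ b)]
    (V₁ : ∀ b, (cmDatum L 2 J).L2 μ →ₗ[ℂ] (A₁ b × Lp (E₁ b) 2 (m₁ b)))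
    (hV₁ : ∀ b, ∀ y ∈ (Submodule.span ℂ (gen₁ b)).topologicalClosure, V₁ b y = 0 → y = 0)
    (Jb₁ : S₁ → Type*) [∀ b, Countable (Jb₁ b)]
    (h₁ : ∀ b, Jb₁ b → C_c(UnitaryGroup.arch (↥(maximalRealSubfield L)) L (IsCMField.complexConj L) 2 J, ℂ))
    (hhl₁ : ∀ b (j : Jb₁ b) (k : ↥(UnitaryGroup.arch (↥(maximalRealSubfield L)) L (IsCMField.complexConj L) 2 J ⊓ unitaryGroupOfForm (conjMixed (↥(maximalRealSubfield L)) L (IsCMField.complexConj L)) 1)) (x : UnitaryGroup.arch (↥(maximalRealSubfield L)) L (IsCMField.complexConj L) 2 J), h₁ b j ((Subgroup.inclusion (inf_le_left : UnitaryGroup.arch (↥(maximalRealSubfield L)) L (IsCMField.complexConj L) 2 J ⊓ unitaryGroupOfForm (conjMixed (↥(maximalRealSubfield L)) L (IsCMField.complexConj L)) 1 ≤ UnitaryGroup.arch (↥(maximalRealSubfield L)) L (IsCMField.complexConj L) 2 J)) k * x) = χ k * h₁ b j x)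
    (hhr₁ : ∀ b (j : Jb₁ b) (k : ↥(UnitaryGroup.arch (↥(maximalRealSubfield L)) L (IsCMField.complexConj L) 2 J ⊓ unitaryGroupOfForm (conjMixed (↥(maximalRealSubfield L)) L (IsCMField.complexConj L)) 1)) (x : UnitaryGroup.arch (↥(maximalRealSubfield L)) L (IsCMField.complexConj L) 2 J), h₁ b j (x * (Subgroup.inclusion (inf_le_left : UnitaryGroup.arch (↥(maximalRealSubfield L)) L (IsCMField.complexConj L) 2 J ⊓ unitaryGroupOfForm (conjMixed (↥(maximalRealSubfield L)) L (IsCMField.complexConj L)) 1 ≤ UnitaryGroup.arch (↥(maximalRealSubfield L)) L (IsCMField.complexConj L) 2 J)) k) = χ k * h₁ b j x)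
    (s₁ : ∀ b, Jb₁ b → Ω₁ b → ℂ) (hs₁ : ∀ b j, MemLp (s₁ b j) ∞ (m₁ b))
    (hU₁ : ∀ b j, ∀ v ∈ LinearMap.eqLocus (P : (cmDatum L 2 J).L2 μ →ₗ[ℂ] (cmDatum L 2 J).L2 μ) LinearMap.id,
      ((V₁ b ∘ₗ (((Submodule.span ℂ (gen₁ b)).topologicalClosure).starProjection : (cmDatum L 2 J).L2 μ →L[ℂ] (cmDatum L 2 J).L2 μ).toLinearMap) (((((cmDatum L 2 J).rightRegular μ).restrict (archToAdelic (↥(maximalRealSubfield L)) L (IsCMField.complexConj L) 2 J)).integratedOperator (((cmDatum L 2 J).isUnitary_rightRegular μ).restrict _) (((cmDatum L 2 J).isStronglyContinuous_rightRegular_holds μ).restrict _ (continuous_archToAdelic (↥(maximalRealSubfield L)) L (IsCMField.complexConj L) 2 J)) νinf (h₁ b j) ∘L (((cmDatum L 2 J).rightRegular μ).restrict (finAdelicToAdelic (↥(maximalRealSubfield L)) L (IsCMField.complexConj L) 2 J)).integratedOperator (((cmDatum L 2 J).isUnitary_rightRegular μ).restrict _) (((cmDatum L 2 J).isStronglyContinuous_rightRegular_holds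 μ).restrict _ (continuous_finAdelicToAdelic (↥(maximalRealSubfield L)) L (IsCMField.complexConj L) 2 J)) νf e) v)).2 = ((hs₁ b j).toLp (s₁ b j) • ((V₁ b ∘ₗ (((Submodule.span ℂ (gen₁ b)).topologicalClosure).starProjection : (cmDatum L 2 J).L2 μ →L[ℂ] (cmDatum L 2 J).L2 μ).toLinearMap) v).2 : Lp (E₁ b) 2 (m₁ b)))
    (hline₁ : ∀ b (c : Jb₁ b → ℂ), m₁ b {x | ∀ j, s₁ b j x = c j} = 0)
    {S₂ : Type*} [Finite S₂] (gen₂ : S₂ → Set ((cmDatum L 2 J).L2 μ))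
    {A₂ : S₂ → Type*} [∀ b, AddCommGroup (A₂ b)] [∀ b, Module ℂ (A₂ b)] [∀ b, FiniteDimensional ℂ (A₂ b)]
    {Ω₂ : S₂ → Type*} {mΩ₂ : ∀ b, MeasurableSpace (Ω₂ b)} (m₂ : ∀ b, Measure (Ω₂ b)) {E₂ : S₂ → Type*} [∀ b, NormedAddCommGroup (E₂ b)] [∀ b, NormedSpace ℂ (E₂ b)]
    (V₂ : ∀ b, (cmDatum L 2 J).L2 μ →ₗ[ℂ] (A₂ b × Lp (E₂ b) 2 (m₂ b)))
    (hV₂ : ∀ b, ∀ y ∈ (Submodule.span ℂ (gen₂ b)).topologicalClosure, V₂ b y = 0 → y = 0)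
    (Jb₂ : S₂ → Type*) [∀ b, Countable (Jb₂ b)]
    (h₂ : ∀ b, Jb₂ b → C_c(UnitaryGroup.arch (↥(maximalRealSubfield L)) L (IsCMField.complexConj L) 2 J, ℂ))
    (hhl₂ : ∀ b (j : Jb₂ b) (k : ↥(UnitaryGroup.arch (↥(maximalRealSubfield L)) L (IsCMField.complexConj L) 2 J ⊓ unitaryGroupOfForm (conjMixed (↥(maximalRealSubfield L)) L (IsCMField.complexConj L)) 1)) (x : UnitaryGroup.arch (↥(maximalRealSubfield L)) L (IsCMField.complexConj L) 2 J), h₂ b j ((Subgroup.inclusion (inf_le_left : UnitaryGroup.arch (↥(maximalRealSubfield L)) L (IsCMField.complexConj L) 2 J ⊓ unitaryGroupOfForm (conjMixed (↥(maximalRealSubfield L)) L (IsCMField.complexConj L)) 1 ≤ UnitaryGroup.arch (↥(maximalRealSubfield L)) L (IsCMField.complexConj L) 2 J)) k * x) = χ k * h₂ b j x)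
    (hhr₂ : ∀ b (j : Jb₂ b) (k : ↥(UnitaryGroup.arch (↥(maximalRealSubfield L)) L (IsCMField.complexConj L) 2 J ⊓ unitaryGroupOfForm (conjMixed (↥(maximalRealSubfield L)) L (IsCMField.complexConj L)) 1)) (x : UnitaryGroup.arch (↥(maximalRealSubfield L)) L (IsCMField.complexConj L) 2 J), h₂ b j (x * (Subgroup.inclusion (inf_le_left : UnitaryGroup.arch (↥(maximalRealSubfield L)) L (IsCMField.complexConj L) 2 J ⊓ unitaryGroupOfForm (conjMixed (↥(maximalRealSubfield L)) L (IsCMField.complexConj L)) 1 ≤ UnitaryGroup.arch (↥(maximalRealSubfield L)) L (IsCMField.complexConj L) 2 J)) k) = χ k * h₂ b j x)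
    (s₂ : ∀ b, Jb₂ b → Ω₂ b → ℂ) (hs₂ : ∀ b j, MemLp (s₂ b j) ∞ (m₂ b))
    (hU₂ : ∀ b j, ∀ v ∈ LinearMap.eqLocus (P : (cmDatum L 2 J).L2 μ →ₗ[ℂ] (cmDatum L 2 J).L2 μ) LinearMap.id,
      ((V₂ b ∘ₗ (((Submodule.span ℂ (gen₂ b)).topologicalClosure).starProjection : (cmDatum L 2 J).L2 μ →L[ℂ] (cmDatum L 2 J).L2 μ).toLinearMap) (((((cmDatum L 2 J).rightRegular μ).restrict (archToAdelic (↥(maximalRealSubfield L)) L (IsCMField.complexConj L) 2 J)).integratedOperator (((cmDatum L 2 J).isUnitary_rightRegular μ).restrict _) (((cmDatum L 2 J).isStronglyContinuous_rightRegular_holds μ).restrict _ (continuous_archToAdelic (↥(maximalRealSubfield L)) L (IsCMField.complexConj L) 2 J)) νinf (h₂ b j) ∘L (((cmDatum L 2 J).rightRegular μ).restrict (finAdelicToAdelic (↥(maximalRealSubfield L)) L (IsCMField.complexConj L) 2 J)).integratedOperator (((cmDatum L 2 J).isUnitary_rightRegular μ).restrict _) (((cmDatum L 2 J).isStronglyContinuous_rightRegular_holds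 μ).restrict _ (continuous_finAdelicToAdelic (↥(maximalRealSubfield L)) L (IsCMField.complexConj L) 2 J)) νf e) v)).2 = ((hs₂ b j).toLp (s₂ b j) • ((V₂ b ∘ₗ (((Submodule.span ℂ (gen₂ b)).topologicalClosure).starProjection : (cmDatum L 2 J).L2 μ →L[ℂ] (cmDatum L 2 J).L2 μ).toLinearMap) v).2 : Lp (E₂ b) 2 (m₂ b)))
    (hline₂ : ∀ b (c : Jb₂ b → ℂ), m₂ b {x | ∀ j, s₂ b j x = c j} = 0)
    (hEis : (((cmDatum L 2 J).cuspidalSubspace μ 𝔓).toSubmoduleᗮ ⊓ (((cmDatum L 2 J).rightRegular μ).restrict ((finAdelicToAdelic (↥(maximalRealSubfield L)) L (IsCMField.complexConj L) 2 J).comp K'.subtype)).invariants ⊓ ⨅ k : ↥(UnitaryGroup.arch (↥(maximalRealSubfield L)) L (IsCMField.complexConj L) 2 J ⊓ unitaryGroupOfForm (conjMixed (↥(maximalRealSubfield L)) L (IsCMField.complexConj L)) 1), Module.End.eigenspace ((((cmDatum L 2 J).rightRegular μ) (((archToAdelic (↥(maximalRealSubfield L)) L (IsCMField.complexConj L) 2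 J).comp (Subgroup.inclusion (inf_le_left : UnitaryGroup.arch (↥(maximalRealSubfield L)) L (IsCMField.complexConj L) 2 J ⊓ unitaryGroupOfForm (conjMixed (↥(maximalRealSubfield L)) L (IsCMField.complexConj L)) 1 ≤ UnitaryGroup.arch (↥(maximalRealSubfield L)) L (IsCMField.complexConj L) 2 J))) k) : (cmDatum L 2 J).L2 μ →L[ℂ] (cmDatum L 2 J).L2 μ) : (cmDatum L 2 J).L2 μ →ₗ[ℂ] (cmDatum L 2 J).L2 μ) (τ k)) ≤
      ((⨆ b, (Submodule.span ℂ (gen₁ b)).topologicalClosure) ⊔ (⨆ b, (Submodule.span ℂ (gen₂ b)).topologicalClosure)).topologicalClosure) :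
    ∃ (P' : (cmDatum L 2 J).L2 μ →L[ℂ] (cmDatum L 2 J).L2 μ) (A' : Submodule ℂ ((cmDatum L 2 J).L2 μ)), FiniteDimensional ℂ A' ∧
      (∀ x : (cmDatum L 2 J).L2 μ, (∀ u ∈ (⟨K', hK'o⟩ : OpenSubgroup (finAdelic (↥(maximalRealSubfield L)) L (IsCMField.complexConj L) 2 J)), ((cmDatum L 2 J).rightRegular μ) ((MonoidHom.id (cmDatum L 2 J).Adelic) ((finAdelicToAdelic (↥(maximalRealSubfield L)) L (IsCMField.complexConj L) 2 J) u)) x = x) →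
        (∀ t : ↥(UnitaryGroup.arch (↥(maximalRealSubfield L)) L (IsCMField.complexConj L) 2 J ⊓ unitaryGroupOfForm (conjMixed (↥(maximalRealSubfield L)) L (IsCMField.complexConj L)) 1), ((cmDatum L 2 J).rightRegular μ) ((MonoidHom.id (cmDatum L 2 J).Adelic) (((archToAdelic (↥(maximalRealSubfield L)) L (IsCMField.complexConj L) 2 J).comp (Subgroup.inclusion (inf_le_left : UnitaryGroup.arch (↥(maximalRealSubfield L)) L (IsCMField.complexConj L) 2 J ⊓ unitaryGroupOfForm (conjMixed (↥(maximalRealSubfield L)) L (IsCMField.complexConj L)) 1 ≤ UnitaryGroup.arch (↥(maximalRealSubfield L)) L (IsCMField.complexConj L) 2 J))) t)) x = τ t • x) → P' x = x) ∧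
      ∀ W : ClosedSubrep (((cmDatum L 2 J).rightRegular μ)), W.toContRep.IsTopIrreducible → W ≤ residualSubspace (cmDatum L 2 J) μ 𝔓 → ∀ w ∈ W, P' w ∈ A' :=
  hatoms_of_noLineMass₂ (cmDatum L 2 J) μ 𝔓 (MonoidHom.id (cmDatum L 2 J).Adelic) ((archToAdelic (↥(maximalRealSubfield L)) L (IsCMField.complexConj L) 2 J).comp (Subgroup.inclusion (inf_le_left : UnitaryGroup.arch (↥(maximalRealSubfield L)) L (IsCMField.complexConj L) 2 J ⊓ unitaryGroupOfForm (conjMixed (↥(maximalRealSubfield L)) L (IsCMField.complexConj L)) 1 ≤ UnitaryGroup.arch (↥(maximalRealSubfield L)) L (IsCMField.complexConj L) 2 J))) (finAdelicToAdelic (↥(maximalRealSubfield L)) L (IsCMField.complexConj L) 2 J) τ ⟨K', hK'o⟩ P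
    (hPfix_kType J μ νf μK χ e τ hχτ K' hK'o he0 he1 P hPdef)
    (((cmDatum L 2 J).cuspidalSubspace μ 𝔓).toSubmoduleᗮ ⊓ (((cmDatum L 2 J).rightRegular μ).restrict ((finAdelicToAdelic (↥(maximalRealSubfield L)) L (IsCMField.complexConj L) 2 J).comp K'.subtype)).invariants ⊓ ⨅ k : ↥(UnitaryGroup.arch (↥(maximalRealSubfield L)) L (IsCMField.complexConj L) 2 J ⊓ unitaryGroupOfForm (conjMixed (↥(maximalRealSubfield L)) L (IsCMField.complexConj L)) 1), Module.End.eigenspace ((((cmDatum L 2 J).rightRegular μ) (((archToAdelic (↥(maximalRealSubfield L)) L (IsCMField.complexConj L) 2 J).comp (Subgroup.inclusion (inf_le_left : UnitaryGroup.arch (↥(maximalRealSubfield L)) L (IsCMField.complexConj L) 2 J ⊓ unitaryGroupOfForm (conjMixed (↥(maximalRealSubfield L)) L (IsCMField.complexConj L)) 1 ≤ UnitaryGroup.arch (↥(maximalRealSubfield L)) L (IsCMField.complexConj L) 2 J))) k) : (cmDatum L 2 J).L2 μ →L[ℂ] (cmDatum L 2 J).L2 μ) : (cmDatum L 2 J).L2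 μ →ₗ[ℂ] (cmDatum L 2 J).L2 μ) (τ k))
    (fun b => (V₁ b ∘ₗ (((Submodule.span ℂ (gen₁ b)).topologicalClosure).starProjection : (cmDatum L 2 J).L2 μ →L[ℂ] (cmDatum L 2 J).L2 μ).toLinearMap)) (fun b => (V₂ b ∘ₗ (((Submodule.span ℂ (gen₂ b)).topologicalClosure).starProjection : (cmDatum L 2 J).L2 μ →L[ℂ] (cmDatum L 2 J).L2 μ).toLinearMap))
    (hEXH₂ (fun b => (Submodule.span ℂ (gen₁ b)).topologicalClosure) (fun b => (Submodule.span ℂ (gen₂ b)).topologicalClosure) (((cmDatum L 2 J).cuspidalSubspace μ 𝔓).toSubmoduleᗮ ⊓ (((cmDatum L 2 J).rightRegular μ).restrict ((finAdelicToAdelic (↥(maximalRealSubfield L)) L (IsCMField.complexConj L) 2 J).comp K'.subtype)).invariants ⊓ ⨅ k : ↥(UnitaryGroup.arch (↥(maximalRealSubfield L)) L (IsCMField.complexConj L) 2 J ⊓ unitaryGroupOfForm (conjMixed (↥(maximalRealSubfield L)) L (IsCMField.complexConj L)) 1), Module.End.eigenspace ((((cmDatum L 2 J).rightRegular μ) (((archToAdelic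 (↥(maximalRealSubfield L)) L (IsCMField.complexConj L) 2 J).comp (Subgroup.inclusion (inf_le_left : UnitaryGroup.arch (↥(maximalRealSubfield L)) L (IsCMField.complexConj L) 2 J ⊓ unitaryGroupOfForm (conjMixed (↥(maximalRealSubfield L)) L (IsCMField.complexConj L)) 1 ≤ UnitaryGroup.arch (↥(maximalRealSubfield L)) L (IsCMField.complexConj L) 2 J))) k) : (cmDatum L 2 J).L2 μ →L[ℂ] (cmDatum L 2 J).L2 μ) : (cmDatum L 2 J).L2 μ →ₗ[ℂ] (cmDatum L 2 J).L2 μ) (τ k)) hEis V₁ hV₁ V₂ hV₂)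
    (hPEis_of_letters μ νf (Subgroup.inclusion (inf_le_left : UnitaryGroup.arch (↥(maximalRealSubfield L)) L (IsCMField.complexConj L) 2 J ⊓ unitaryGroupOfForm (conjMixed (↥(maximalRealSubfield L)) L (IsCMField.complexConj L)) 1 ≤ UnitaryGroup.arch (↥(maximalRealSubfield L)) L (IsCMField.complexConj L) 2 J)) (continuous_induced_rng.2 continuous_subtype_val) μK χ e (hχmul_of_kType χ τ hχτ) (hχone_of_kType χ τ hχτ) K' he0 he1 heK P hPdef 𝔓 (((cmDatum L 2 J).cuspidalSubspace μ 𝔓).toSubmoduleᗮ ⊓ (((cmDatum L 2 J).rightRegular μ).restrict ((finAdelicToAdelic (↥(maximalRealSubfield L)) L (IsCMField.complexConj L) 2 J).comp K'.subtype)).invariants ⊓ ⨅ k : ↥(UnitaryGroup.arch (↥(maximalRealSubfield L)) L (IsCMField.complexConj L) 2 J ⊓ unitaryGroupOfForm (conjMixed (↥(maximalRealSubfield L)) L (IsCMField.complexConj L)) 1), Module.End.eigenspace ((((cmDatum L 2 J).rightRegular μ) (((archToAdelic (↥(maximalRealSubfield L)) L (IsCMField.complexConj L) 2 J).comp (Subgroup.inclusion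 (inf_le_left : UnitaryGroup.arch (↥(maximalRealSubfield L)) L (IsCMField.complexConj L) 2 J ⊓ unitaryGroupOfForm (conjMixed (↥(maximalRealSubfield L)) L (IsCMField.complexConj L)) 1 ≤ UnitaryGroup.arch (↥(maximalRealSubfield L)) L (IsCMField.complexConj L) 2 J))) k) : (cmDatum L 2 J).L2 μ →L[ℂ] (cmDatum L 2 J).L2 μ) : (cmDatum L 2 J).L2 μ →ₗ[ℂ] (cmDatum L 2 J).L2 μ) (τ k))
      (hEisdef_kType_split J μ νf μK χ e τ hχτ K' heK P hPdef 𝔓))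
    (hD5_letterFree_two_of_letters J μ νinf νf μK χ e hJc hJ2 hJw (hχmul_of_kType χ τ hχτ) (hχone_of_kType χ τ hχτ) (hχinv_of_kType χ τ hχτ hτ) K' he0 he1 heK hestar P hPdef 𝔓 gen₁ m₁ V₁ Jb₁ h₁ hhl₁ hhr₁ s₁ hs₁ hU₁ hline₁)
    (hD5_letterFree_two_of_letters J μ νinf νf μK χ e hJc hJ2 hJw (hχmul_of_kType χ τ hχτ) (hχone_of_kType χ τ hχτ) (hχinv_of_kType χ τ hχτ hτ) K' he0 he1 heK hestar P hPdef 𝔓 gen₂ m₂ V₂ Jb₂ h₂ hhl₂ hhr₂ s₂ hs₂ hU₂ hline₂)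

set_option maxHeartbeats 400000 in -- measured (R36): farm-direct cost of this decl ∈ (150000, 200000] at the default 200000 (probes 150000 ✗ ∕ 200000 ✓) = lake-cliff class (BF-N26∕N27); scoped 400000 = 2×
/-- **RUNG 1 AT THE SCALAR `K_∞`-TYPE `τ`, TWO-FAMILY PLUG EDITION (HEAD)**: «the `K′`-invariant, `τ`-isotypic part of `L²_res(U(J)_{L∕L⁺}, 𝔓)` is FINITE-DIMENSIONAL», modulo
`hEis : Eis_τ ≤ closure ((⨆ closure span gen₁) ⊔ (⨆ closure span gen₂))` (C7″∕NAMED_τ + the OD∕SD split), block coordinates injective on the blocks, and the per-block model letters of EACH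
family — ★ `residual_kType_finiteDimensional_of_atoms` ∘ `hatoms_kType_letterFree_of_twoBlockFamilies`.  At `τ = 1` this is p23's ★ head (§2).
[cite: MoeglinWaldspurger1995, I.2.18, V.3.13] [cite: HarishChandra1968, Thm. 1] -/
theorem residual_kType_finiteDimensional_letterFree_of_twoBlockFamilies [MeasurableMul (finAdelic (↥(maximalRealSubfield L)) L (IsCMField.complexConj L) 2 J)] [ENNReal.HolderTriple ∞ 2 2]
    (hJc : J.map (IsCMField.complexConj L : L → L) = J) (hJ2 : J * J = 1)
    (hJw : ∀ w : {w : InfinitePlace L // IsComplex w}, J.map w.1.embedding = !![(0 : ℂ), 1; 1, 0])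
    (τ : ↥(UnitaryGroup.arch (↥(maximalRealSubfield L)) L (IsCMField.complexConj L) 2 J ⊓ unitaryGroupOfForm (conjMixed (↥(maximalRealSubfield L)) L (IsCMField.complexConj L)) 1) →* ℂ) (hχτ : ∀ k, χ k = (τ k)⁻¹) (hτ : ∀ k, ‖τ k‖ = 1)
    (K' : Subgroup (finAdelic (↥(maximalRealSubfield L)) L (IsCMField.complexConj L) 2 J)) (hK'o : IsOpen (K' : Set (finAdelic (↥(maximalRealSubfield L)) L (IsCMField.complexConj L) 2 J))) (he0 : ∀ x, x ∉ K' → e x = 0) (he1 : ∫ x, e x ∂νf = 1)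
    (heK : ∀ k ∈ K', ∀ x, e (k * x) = e x) (hestar : ∀ x, mulStar (⇑e) x = e x)
    (P : (cmDatum L 2 J).L2 μ →L[ℂ] (cmDatum L 2 J).L2 μ) (hPdef : P = ((((cmDatum L 2 J).rightRegular μ).restrict ((archToAdelic (↥(maximalRealSubfield L)) L (IsCMField.complexConj L) 2 J).comp (Subgroup.inclusion (inf_le_left : UnitaryGroup.arch (↥(maximalRealSubfield L)) L (IsCMField.complexConj L) 2 J ⊓ unitaryGroupOfForm (conjMixed (↥(maximalRealSubfield L)) L (IsCMField.complexConj L)) 1 ≤ UnitaryGroup.arch (↥(maximalRealSubfield L)) L (IsCMField.complexConj L) 2 J)))).integratedOperator (((cmDatum L 2 J).isUnitary_rightRegular μ).restrict _)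
          (((cmDatum L 2 J).isStronglyContinuous_rightRegular_holds μ).restrict _ ((continuous_archToAdelic (↥(maximalRealSubfield L)) L (IsCMField.complexConj L) 2 J).comp (continuous_induced_rng.2 continuous_subtype_val))) μK χ ∘L
        (((cmDatum L 2 J).rightRegular μ).restrict (finAdelicToAdelic (↥(maximalRealSubfield L)) L (IsCMField.complexConj L) 2 J)).integratedOperator (((cmDatum L 2 J).isUnitary_rightRegular μ).restrict _) (((cmDatum L 2 J).isStronglyContinuous_rightRegular_holds μ).restrict _ (continuous_finAdelicToAdelic (↥(maximalRealSubfield L)) L (IsCMField.complexConj L) 2 J)) νf e))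
    (𝔓 : (cmDatum L 2 J).ParabolicUnipotentData)
    {S₁ : Type*} (gen₁ : S₁ → Set ((cmDatum L 2 J).L2 μ))
    {A₁ : S₁ → Type*} [∀ b, AddCommGroup (A₁ b)] [∀ b, Module ℂ (A₁ b)] [∀ b, Subsingleton (A₁ b)]
    {Ω₁ : S₁ → Type*} {mΩ₁ : ∀ b, MeasurableSpace (Ω₁ b)} (m₁ : ∀ b, Measure (Ω₁ b)) {E₁ : S₁ → Type*} [∀ b, NormedAddCommGroup (E₁ b)] [∀ b, NormedSpace ℂ (E₁ b)]
    (V₁ : ∀ b, (cmDatum L 2 J).L2 μ →ₗ[ℂ] (A₁ b × Lp (E₁ b) 2 (m₁ b)))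
    (hV₁ : ∀ b, ∀ y ∈ (Submodule.span ℂ (gen₁ b)).topologicalClosure, V₁ b y = 0 → y = 0)
    (Jb₁ : S₁ → Type*) [∀ b, Countable (Jb₁ b)]
    (h₁ : ∀ b, Jb₁ b → C_c(UnitaryGroup.arch (↥(maximalRealSubfield L)) L (IsCMField.complexConj L) 2 J, ℂ))
    (hhl₁ : ∀ b (j : Jb₁ b) (k : ↥(UnitaryGroup.arch (↥(maximalRealSubfield L)) L (IsCMField.complexConj L) 2 J ⊓ unitaryGroupOfForm (conjMixed (↥(maximalRealSubfield L)) L (IsCMField.complexConj L)) 1)) (x : UnitaryGroup.arch (↥(maximalRealSubfield L)) L (IsCMField.complexConj L) 2 J), h₁ b j ((Subgroup.inclusion (inf_le_left : UnitaryGroup.arch (↥(maximalRealSubfield L)) L (IsCMField.complexConj L) 2 J ⊓ unitaryGroupOfForm (conjMixed (↥(maximalRealSubfield L)) L (IsCMField.complexConj L)) 1 ≤ UnitaryGroup.arch (↥(maximalRealSubfield L)) L (IsCMField.complexConj L) 2 J)) k * x) = χ k * h₁ b j x)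
    (hhr₁ : ∀ b (j : Jb₁ b) (k : ↥(UnitaryGroup.arch (↥(maximalRealSubfield L)) L (IsCMField.complexConj L) 2 J ⊓ unitaryGroupOfForm (conjMixed (↥(maximalRealSubfield L)) L (IsCMField.complexConj L)) 1)) (x : UnitaryGroup.arch (↥(maximalRealSubfield L)) L (IsCMField.complexConj L) 2 J), h₁ b j (x * (Subgroup.inclusion (inf_le_left : UnitaryGroup.arch (↥(maximalRealSubfield L)) L (IsCMField.complexConj L) 2 J ⊓ unitaryGroupOfForm (conjMixed (↥(maximalRealSubfield L)) L (IsCMField.complexConj L)) 1 ≤ UnitaryGroup.arch (↥(maximalRealSubfield L)) L (IsCMField.complexConj L) 2 J)) k) = χ k * h₁ b j x)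
    (s₁ : ∀ b, Jb₁ b → Ω₁ b → ℂ) (hs₁ : ∀ b j, MemLp (s₁ b j) ∞ (m₁ b))
    (hU₁ : ∀ b j, ∀ v ∈ LinearMap.eqLocus (P : (cmDatum L 2 J).L2 μ →ₗ[ℂ] (cmDatum L 2 J).L2 μ) LinearMap.id,
      ((V₁ b ∘ₗ (((Submodule.span ℂ (gen₁ b)).topologicalClosure).starProjection : (cmDatum L 2 J).L2 μ →L[ℂ] (cmDatum L 2 J).L2 μ).toLinearMap) (((((cmDatum L 2 J).rightRegular μ).restrict (archToAdelic (↥(maximalRealSubfield L)) L (IsCMField.complexConj L) 2 J)).integratedOperator (((cmDatum L 2 J).isUnitary_rightRegular μ).restrict _) (((cmDatum L 2 J).isStronglyContinuous_rightRegular_holds μ).restrict _ (continuous_archToAdelic (↥(maximalRealSubfield L)) L (IsCMField.complexConj L) 2 J)) νinf (h₁ b j) ∘L (((cmDatum L 2 J).rightRegular μ).restrict (finAdelicToAdelic (↥(maximalRealSubfield L)) L (IsCMField.complexConj L) 2 J)).integratedOperator (((cmDatum L 2 J).isUnitary_rightRegular μ).restrict _) (((cmDatum L 2 J).isStronglyContinuous_rightRegular_holds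 μ).restrict _ (continuous_finAdelicToAdelic (↥(maximalRealSubfield L)) L (IsCMField.complexConj L) 2 J)) νf e) v)).2 = ((hs₁ b j).toLp (s₁ b j) • ((V₁ b ∘ₗ (((Submodule.span ℂ (gen₁ b)).topologicalClosure).starProjection : (cmDatum L 2 J).L2 μ →L[ℂ] (cmDatum L 2 J).L2 μ).toLinearMap) v).2 : Lp (E₁ b) 2 (m₁ b)))
    (hline₁ : ∀ b (c : Jb₁ b → ℂ), m₁ b {x | ∀ j, s₁ b j x = c j} = 0)
    {S₂ : Type*} [Finite S₂] (gen₂ : S₂ → Set ((cmDatum L 2 J).L2 μ))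
    {A₂ : S₂ → Type*} [∀ b, AddCommGroup (A₂ b)] [∀ b, Module ℂ (A₂ b)] [∀ b, FiniteDimensional ℂ (A₂ b)]
    {Ω₂ : S₂ → Type*} {mΩ₂ : ∀ b, MeasurableSpace (Ω₂ b)} (m₂ : ∀ b, Measure (Ω₂ b)) {E₂ : S₂ → Type*} [∀ b, NormedAddCommGroup (E₂ b)] [∀ b, NormedSpace ℂ (E₂ b)]
    (V₂ : ∀ b, (cmDatum L 2 J).L2 μ →ₗ[ℂ] (A₂ b × Lp (E₂ b) 2 (m₂ b)))
    (hV₂ : ∀ b, ∀ y ∈ (Submodule.span ℂ (gen₂ b)).topologicalClosure, V₂ b y = 0 → y = 0)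
    (Jb₂ : S₂ → Type*) [∀ b, Countable (Jb₂ b)]
    (h₂ : ∀ b, Jb₂ b → C_c(UnitaryGroup.arch (↥(maximalRealSubfield L)) L (IsCMField.complexConj L) 2 J, ℂ))
    (hhl₂ : ∀ b (j : Jb₂ b) (k : ↥(UnitaryGroup.arch (↥(maximalRealSubfield L)) L (IsCMField.complexConj L) 2 J ⊓ unitaryGroupOfForm (conjMixed (↥(maximalRealSubfield L)) L (IsCMField.complexConj L)) 1)) (x : UnitaryGroup.arch (↥(maximalRealSubfield L)) L (IsCMField.complexConj L) 2 J), h₂ b j ((Subgroup.inclusion (inf_le_left : UnitaryGroup.arch (↥(maximalRealSubfield L)) L (IsCMField.complexConj L) 2 J ⊓ unitaryGroupOfForm (conjMixed (↥(maximalRealSubfield L)) L (IsCMField.complexConj L)) 1 ≤ UnitaryGroup.arch (↥(maximalRealSubfield L)) L (IsCMField.complexConj L) 2 J)) k * x) = χ k * h₂ b j x)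
    (hhr₂ : ∀ b (j : Jb₂ b) (k : ↥(UnitaryGroup.arch (↥(maximalRealSubfield L)) L (IsCMField.complexConj L) 2 J ⊓ unitaryGroupOfForm (conjMixed (↥(maximalRealSubfield L)) L (IsCMField.complexConj L)) 1)) (x : UnitaryGroup.arch (↥(maximalRealSubfield L)) L (IsCMField.complexConj L) 2 J), h₂ b j (x * (Subgroup.inclusion (inf_le_left : UnitaryGroup.arch (↥(maximalRealSubfield L)) L (IsCMField.complexConj L) 2 J ⊓ unitaryGroupOfForm (conjMixed (↥(maximalRealSubfield L)) L (IsCMField.complexConj L)) 1 ≤ UnitaryGroup.arch (↥(maximalRealSubfield L)) L (IsCMField.complexConj L) 2 J)) k) = χ k * h₂ b j x)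
    (s₂ : ∀ b, Jb₂ b → Ω₂ b → ℂ) (hs₂ : ∀ b j, MemLp (s₂ b j) ∞ (m₂ b))
    (hU₂ : ∀ b j, ∀ v ∈ LinearMap.eqLocus (P : (cmDatum L 2 J).L2 μ →ₗ[ℂ] (cmDatum L 2 J).L2 μ) LinearMap.id,
      ((V₂ b ∘ₗ (((Submodule.span ℂ (gen₂ b)).topologicalClosure).starProjection : (cmDatum L 2 J).L2 μ →L[ℂ] (cmDatum L 2 J).L2 μ).toLinearMap) (((((cmDatum L 2 J).rightRegular μ).restrict (archToAdelic (↥(maximalRealSubfield L)) L (IsCMField.complexConj L) 2 J)).integratedOperator (((cmDatum L 2 J).isUnitary_rightRegular μ).restrict _) (((cmDatum L 2 J).isStronglyContinuous_rightRegular_holds μ).restrict _ (continuous_archToAdelic (↥(maximalRealSubfield L)) L (IsCMField.complexConj L) 2 J)) νinf (h₂ b j) ∘L (((cmDatum L 2 J).rightRegular μ).restrict (finAdelicToAdelic (↥(maximalRealSubfield L)) L (IsCMField.complexConj L) 2 J)).integratedOperator (((cmDatum L 2 J).isUnitary_rightRegular μ).restrict _) (((cmDatum L 2 J).isStronglyContinuous_rightRegular_holds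 μ).restrict _ (continuous_finAdelicToAdelic (↥(maximalRealSubfield L)) L (IsCMField.complexConj L) 2 J)) νf e) v)).2 = ((hs₂ b j).toLp (s₂ b j) • ((V₂ b ∘ₗ (((Submodule.span ℂ (gen₂ b)).topologicalClosure).starProjection : (cmDatum L 2 J).L2 μ →L[ℂ] (cmDatum L 2 J).L2 μ).toLinearMap) v).2 : Lp (E₂ b) 2 (m₂ b)))
    (hline₂ : ∀ b (c : Jb₂ b → ℂ), m₂ b {x | ∀ j, s₂ b j x = c j} = 0)
    (hEis : (((cmDatum L 2 J).cuspidalSubspace μ 𝔓).toSubmoduleᗮ ⊓ (((cmDatum L 2 J).rightRegular μ).restrict ((finAdelicToAdelic (↥(maximalRealSubfield L)) L (IsCMField.complexConj L) 2 J).comp K'.subtype)).invariants ⊓ ⨅ k : ↥(UnitaryGroup.arch (↥(maximalRealSubfield L)) L (IsCMField.complexConj L) 2 J ⊓ unitaryGroupOfForm (conjMixed (↥(maximalRealSubfield L)) L (IsCMField.complexConj L)) 1), Module.End.eigenspace ((((cmDatum L 2 J).rightRegular μ) (((archToAdelic (↥(maximalRealSubfield L)) L (IsCMField.complexConj L) 2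 J).comp (Subgroup.inclusion (inf_le_left : UnitaryGroup.arch (↥(maximalRealSubfield L)) L (IsCMField.complexConj L) 2 J ⊓ unitaryGroupOfForm (conjMixed (↥(maximalRealSubfield L)) L (IsCMField.complexConj L)) 1 ≤ UnitaryGroup.arch (↥(maximalRealSubfield L)) L (IsCMField.complexConj L) 2 J))) k) : (cmDatum L 2 J).L2 μ →L[ℂ] (cmDatum L 2 J).L2 μ) : (cmDatum L 2 J).L2 μ →ₗ[ℂ] (cmDatum L 2 J).L2 μ) (τ k)) ≤
      ((⨆ b, (Submodule.span ℂ (gen₁ b)).topologicalClosure) ⊔ (⨆ b, (Submodule.span ℂ (gen₂ b)).topologicalClosure)).topologicalClosure) :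
    FiniteDimensional ℂ ↥((residualSubspace (cmDatum L 2 J) μ 𝔓).toSubmodule ⊓
      (((cmDatum L 2 J).rightRegular μ).restrict ((finAdelicToAdelic (↥(maximalRealSubfield L)) L (IsCMField.complexConj L) 2 J).comp K'.subtype)).invariants ⊓
      ⨅ k : ↥(UnitaryGroup.arch (↥(maximalRealSubfield L)) L (IsCMField.complexConj L) 2 J ⊓ unitaryGroupOfForm (conjMixed (↥(maximalRealSubfield L)) L (IsCMField.complexConj L)) 1), Module.End.eigenspace ((((cmDatum L 2 J).rightRegular μ) (((archToAdelic (↥(maximalRealSubfield L)) L (IsCMField.complexConj L) 2 J).comp (Subgroup.inclusion (inf_le_left : UnitaryGroup.arch (↥(maximalRealSubfield L)) L (IsCMField.complexConj L) 2 J ⊓ unitaryGroupOfForm (conjMixed (↥(maximalRealSubfield L)) L (IsCMField.complexConj L)) 1 ≤ UnitaryGroup.arch (↥(maximalRealSubfield L)) L (IsCMField.complexConj L) 2 J))) k) : (cmDatum L 2 J).L2 μ →L[ℂ] (cmDatum L 2 J).L2 μ) : (cmDatum L 2 J).L2 μ →ₗ[ℂ] (cmDatum L 2 J).L2 μ) (τ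 k)) := by
  obtain ⟨P', A', hA', hfix, hmem⟩ := hatoms_kType_letterFree_of_twoBlockFamilies J μ νinf νf μK χ e hJc hJ2 hJw τ hχτ hτ
    K' hK'o he0 he1 heK hestar P hPdef 𝔓 gen₁ m₁ V₁ hV₁ Jb₁ h₁ hhl₁ hhr₁ s₁ hs₁ hU₁ hline₁ gen₂ m₂ V₂ hV₂ Jb₂ h₂ hhl₂ hhr₂ s₂ hs₂ hU₂ hline₂ hEis
  refine residual_kType_finiteDimensional_of_atoms (cmDatum L 2 J) μ 𝔓 ((archToAdelic (↥(maximalRealSubfield L)) L (IsCMField.complexConj L) 2 J).comp (Subgroup.inclusion (inf_le_left : UnitaryGroup.arch (↥(maximalRealSubfield L)) L (IsCMField.complexConj L) 2 J ⊓ unitaryGroupOfForm (conjMixed (↥(maximalRealSubfield L)) L (IsCMField.complexConj L)) 1 ≤ UnitaryGroup.arch (↥(maximalRealSubfield L)) L (IsCMField.complexConj L) 2 J))) (finAdelicToAdelic (↥(maximalRealSubfield L)) L (IsCMField.complexConj L) 2 J) K' τ ⟨P', A', hA', fun x hxU hxK => hfix x (fun u hu => hxU u hu) (fun t => ?_), 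hmem⟩
  exact hxK t

end CM

/-! ## §2 WITNESS at `τ = 1`: p23's ★ head, verbatim, from the `τ`-head -/

section Witness

variable {L : Type} [Field L] [NumberField L] [IsCMField L] (J : Matrix (Fin 2) (Fin 2) L)
  (μ : Measure (cmDatum L 2 J).automorphicQuotient) [(cmDatum L 2 J).IsAutomorphicMeasure μ]
  [MeasurableSpace (UnitaryGroup.arch (↥(maximalRealSubfield L)) L (IsCMField.complexConj L) 2 J)] [BorelSpace (UnitaryGroup.arch (↥(maximalRealSubfield L)) L (IsCMField.complexConj L) 2 J)]
  [MeasurableSpace (finAdelic (↥(maximalRealSubfield L)) L (IsCMField.complexConj L) 2 J)] [BorelSpace (finAdelic (↥(maximalRealSubfield L)) L (IsCMField.complexConj L) 2 J)]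
  (νinf : Measure (UnitaryGroup.arch (↥(maximalRealSubfield L)) L (IsCMField.complexConj L) 2 J)) [IsHaarMeasure νinf] [νinf.IsInvInvariant] [SFinite νinf]
  (νf : Measure (finAdelic (↥(maximalRealSubfield L)) L (IsCMField.complexConj L) 2 J)) [IsFiniteMeasureOnCompacts νf] [νf.IsMulLeftInvariant] [νf.IsInvInvariant] [νf.IsOpenPosMeasure]
  [MeasurableSpace ↥(UnitaryGroup.arch (↥(maximalRealSubfield L)) L (IsCMField.complexConj L) 2 J ⊓ unitaryGroupOfForm (conjMixed (↥(maximalRealSubfield L)) L (IsCMField.complexConj L)) 1)] [BorelSpace ↥(UnitaryGroup.arch (↥(maximalRealSubfield L)) L (IsCMField.complexConj L) 2 J ⊓ unitaryGroupOfForm (conjMixed (↥(maximalRealSubfield L)) L (IsCMField.complexConj L)) 1)]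
  (μK : Measure ↥(UnitaryGroup.arch (↥(maximalRealSubfield L)) L (IsCMField.complexConj L) 2 J ⊓ unitaryGroupOfForm (conjMixed (↥(maximalRealSubfield L)) L (IsCMField.complexConj L)) 1)) [IsProbabilityMeasure μK] [μK.IsMulLeftInvariant] [μK.IsMulRightInvariant] [μK.IsInvInvariant]
  (χ : C_c(↥(UnitaryGroup.arch (↥(maximalRealSubfield L)) L (IsCMField.complexConj L) 2 J ⊓ unitaryGroupOfForm (conjMixed (↥(maximalRealSubfield L)) L (IsCMField.complexConj L)) 1), ℂ)) (e : C_c(finAdelic (↥(maximalRealSubfield L)) L (IsCMField.complexConj L) 2 J, ℂ))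


set_option maxHeartbeats 400000 in -- measured (R36): farm-direct cost of this decl ∈ (100000, 200000] at the default 200000 (probe 100000 ✗ ∕ 200000 ✓); scoped 400000 keeps ≥ 2× off lake's cliff (BF-N26∕N27 class)
/- **NON-VACUITY WITNESS (an `example`, so that p23's ★ statement is not re-declared — gate `dedup.landed`) — p23's ★ `residual_invariants_finiteDimensional_letterFree_of_twoBlockFamilies`
RE-DERIVED FROM THE `τ`-HEAD AT `τ = 1`** (statement verbatim: general
`Kad ≤ closure (ι_∞ incl (K_∞) ∪ ι_f(K′))`, `χ ≡ 1`, `Eis(Kad) = (L²_cusp)ᗮ ⊓ (R|_{Kad})-invariants`): `τ := 1`, `hχτ ∕ hτ` from `hχ1`; `Eis_1 ≤ Eis(Kad)` (★ `eisOne_split_le_eis`) feeds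
`hEis`; `(R ∘ ι_∞ incl)-invariants ≤ ⨅_k eigenspace (R (ι_∞ incl k)) 1` (★ `invariants_le_iInf_eigenspace_one`) transports the conclusion.
[cite: MoeglinWaldspurger1995, I.2.18, V.3.13] [cite: HarishChandra1968, Thm. 1] -/
example [MeasurableMul (finAdelic (↥(maximalRealSubfield L)) L (IsCMField.complexConj L) 2 J)] [ENNReal.HolderTriple ∞ 2 2]
    (hJc : J.map (IsCMField.complexConj L : L → L) = J) (hJ2 : J * J = 1)
    (hJw : ∀ w : {w : InfinitePlace L // IsComplex w}, J.map w.1.embedding = !![(0 : ℂ), 1; 1, 0])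
    (hχ1 : ∀ k, χ k = 1)
    (K' : Subgroup (finAdelic (↥(maximalRealSubfield L)) L (IsCMField.complexConj L) 2 J)) (hK'o : IsOpen (K' : Set (finAdelic (↥(maximalRealSubfield L)) L (IsCMField.complexConj L) 2 J))) (he0 : ∀ x, x ∉ K' → e x = 0) (he1 : ∫ x, e x ∂νf = 1)
    (heK : ∀ k ∈ K', ∀ x, e (k * x) = e x) (hestar : ∀ x, mulStar (⇑e) x = e x)
    (P : (cmDatum L 2 J).L2 μ →L[ℂ] (cmDatum L 2 J).L2 μ) (hPdef : P = ((((cmDatum L 2 J).rightRegular μ).restrict ((archToAdelic (↥(maximalRealSubfield L)) L (IsCMField.complexConj L) 2 J).comp (Subgroup.inclusion (inf_le_left : UnitaryGroup.arch (↥(maximalRealSubfield L)) L (IsCMField.complexConj L) 2 J ⊓ unitaryGroupOfForm (conjMixed (↥(maximalRealSubfield L)) L (IsCMField.complexConj L)) 1 ≤ UnitaryGroup.arch (↥(maximalRealSubfield L)) L (IsCMField.complexConj L) 2 J)))).integratedOperator (((cmDatum L 2 J).isUnitary_rightRegular μ).restrict _)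
          (((cmDatum L 2 J).isStronglyContinuous_rightRegular_holds μ).restrict _ ((continuous_archToAdelic (↥(maximalRealSubfield L)) L (IsCMField.complexConj L) 2 J).comp (continuous_induced_rng.2 continuous_subtype_val))) μK χ ∘L
        (((cmDatum L 2 J).rightRegular μ).restrict (finAdelicToAdelic (↥(maximalRealSubfield L)) L (IsCMField.complexConj L) 2 J)).integratedOperator (((cmDatum L 2 J).isUnitary_rightRegular μ).restrict _) (((cmDatum L 2 J).isStronglyContinuous_rightRegular_holds μ).restrict _ (continuous_finAdelicToAdelic (↥(maximalRealSubfield L)) L (IsCMField.complexConj L) 2 J)) νf e))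
    (𝔓 : (cmDatum L 2 J).ParabolicUnipotentData)
    (Kad : Subgroup (cmDatum L 2 J).Adelic) (hKad : Kad ≤ (Subgroup.closure (Set.range (fun k : ↥(UnitaryGroup.arch (↥(maximalRealSubfield L)) L (IsCMField.complexConj L) 2 J ⊓ unitaryGroupOfForm (conjMixed (↥(maximalRealSubfield L)) L (IsCMField.complexConj L)) 1) => (archToAdelic (↥(maximalRealSubfield L)) L (IsCMField.complexConj L) 2 J) ((Subgroup.inclusion (inf_le_left : UnitaryGroup.arch (↥(maximalRealSubfield L)) L (IsCMField.complexConj L) 2 J ⊓ unitaryGroupOfForm (conjMixed (↥(maximalRealSubfield L)) L (IsCMField.complexConj L)) 1 ≤ UnitaryGroup.arch (↥(maximalRealSubfield L)) L (IsCMField.complexConj L) 2 J)) k)) ∪ (finAdelicToAdelic (↥(maximalRealSubfield L)) L (IsCMField.complexConj L) 2 J) '' (K' : Set (finAdelic (↥(maximalRealSubfield L)) L (IsCMField.complexConj L) 2 J)))))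
    {S₁ : Type*} (gen₁ : S₁ → Set ((cmDatum L 2 J).L2 μ))
    {A₁ : S₁ → Type*} [∀ b, AddCommGroup (A₁ b)] [∀ b, Module ℂ (A₁ b)] [∀ b, Subsingleton (A₁ b)]
    {Ω₁ : S₁ → Type*} {mΩ₁ : ∀ b, MeasurableSpace (Ω₁ b)} (m₁ : ∀ b, Measure (Ω₁ b)) {E₁ : S₁ → Type*} [∀ b, NormedAddCommGroup (E₁ b)] [∀ b, NormedSpace ℂ (E₁ b)]
    (V₁ : ∀ b, (cmDatum L 2 J).L2 μ →ₗ[ℂ] (A₁ b × Lp (E₁ b) 2 (m₁ b)))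
    (hV₁ : ∀ b, ∀ y ∈ (Submodule.span ℂ (gen₁ b)).topologicalClosure, V₁ b y = 0 → y = 0)
    (Jb₁ : S₁ → Type*) [∀ b, Countable (Jb₁ b)]
    (h₁ : ∀ b, Jb₁ b → C_c(UnitaryGroup.arch (↥(maximalRealSubfield L)) L (IsCMField.complexConj L) 2 J, ℂ))
    (hhl₁ : ∀ b (j : Jb₁ b) (k : ↥(UnitaryGroup.arch (↥(maximalRealSubfield L)) L (IsCMField.complexConj L) 2 J ⊓ unitaryGroupOfForm (conjMixed (↥(maximalRealSubfield L)) L (IsCMField.complexConj L)) 1)) (x : UnitaryGroup.arch (↥(maximalRealSubfield L)) L (IsCMField.complexConj L) 2 J), h₁ b j ((Subgroup.inclusion (inf_le_left : UnitaryGroup.arch (↥(maximalRealSubfield L)) L (IsCMField.complexConj L) 2 J ⊓ unitaryGroupOfForm (conjMixed (↥(maximalRealSubfield L)) L (IsCMField.complexConj L)) 1 ≤ UnitaryGroup.arch (↥(maximalRealSubfield L)) L (IsCMField.complexConj L) 2 J)) k * x) = χ k * h₁ b j x)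
    (hhr₁ : ∀ b (j : Jb₁ b) (k : ↥(UnitaryGroup.arch (↥(maximalRealSubfield L)) L (IsCMField.complexConj L) 2 J ⊓ unitaryGroupOfForm (conjMixed (↥(maximalRealSubfield L)) L (IsCMField.complexConj L)) 1)) (x : UnitaryGroup.arch (↥(maximalRealSubfield L)) L (IsCMField.complexConj L) 2 J), h₁ b j (x * (Subgroup.inclusion (inf_le_left : UnitaryGroup.arch (↥(maximalRealSubfield L)) L (IsCMField.complexConj L) 2 J ⊓ unitaryGroupOfForm (conjMixed (↥(maximalRealSubfield L)) L (IsCMField.complexConj L)) 1 ≤ UnitaryGroup.arch (↥(maximalRealSubfield L)) L (IsCMField.complexConj L) 2 J)) k) = χ k * h₁ b j x)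
    (s₁ : ∀ b, Jb₁ b → Ω₁ b → ℂ) (hs₁ : ∀ b j, MemLp (s₁ b j) ∞ (m₁ b))
    (hU₁ : ∀ b j, ∀ v ∈ LinearMap.eqLocus (P : (cmDatum L 2 J).L2 μ →ₗ[ℂ] (cmDatum L 2 J).L2 μ) LinearMap.id,
      ((V₁ b ∘ₗ (((Submodule.span ℂ (gen₁ b)).topologicalClosure).starProjection : (cmDatum L 2 J).L2 μ →L[ℂ] (cmDatum L 2 J).L2 μ).toLinearMap) (((((cmDatum L 2 J).rightRegular μ).restrict (archToAdelic (↥(maximalRealSubfield L)) L (IsCMField.complexConj L) 2 J)).integratedOperator (((cmDatum L 2 J).isUnitary_rightRegular μ).restrict _) (((cmDatum L 2 J).isStronglyContinuous_rightRegular_holds μ).restrict _ (continuous_archToAdelic (↥(maximalRealSubfield L)) L (IsCMField.complexConj L) 2 J)) νinf (h₁ b j) ∘L (((cmDatum L 2 J).rightRegular μ).restrict (finAdelicToAdelic (↥(maximalRealSubfield L)) L (IsCMField.complexConj L) 2 J)).integratedOperator (((cmDatum L 2 J).isUnitary_rightRegular μ).restrict _) (((cmDatum L 2 J).isStronglyContinuous_rightRegular_holds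 μ).restrict _ (continuous_finAdelicToAdelic (↥(maximalRealSubfield L)) L (IsCMField.complexConj L) 2 J)) νf e) v)).2 = ((hs₁ b j).toLp (s₁ b j) • ((V₁ b ∘ₗ (((Submodule.span ℂ (gen₁ b)).topologicalClosure).starProjection : (cmDatum L 2 J).L2 μ →L[ℂ] (cmDatum L 2 J).L2 μ).toLinearMap) v).2 : Lp (E₁ b) 2 (m₁ b)))
    (hline₁ : ∀ b (c : Jb₁ b → ℂ), m₁ b {x | ∀ j, s₁ b j x = c j} = 0)
    {S₂ : Type*} [Finite S₂] (gen₂ : S₂ → Set ((cmDatum L 2 J).L2 μ))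
    {A₂ : S₂ → Type*} [∀ b, AddCommGroup (A₂ b)] [∀ b, Module ℂ (A₂ b)] [∀ b, FiniteDimensional ℂ (A₂ b)]
    {Ω₂ : S₂ → Type*} {mΩ₂ : ∀ b, MeasurableSpace (Ω₂ b)} (m₂ : ∀ b, Measure (Ω₂ b)) {E₂ : S₂ → Type*} [∀ b, NormedAddCommGroup (E₂ b)] [∀ b, NormedSpace ℂ (E₂ b)]
    (V₂ : ∀ b, (cmDatum L 2 J).L2 μ →ₗ[ℂ] (A₂ b × Lp (E₂ b) 2 (m₂ b)))
    (hV₂ : ∀ b, ∀ y ∈ (Submodule.span ℂ (gen₂ b)).topologicalClosure, V₂ b y = 0 → y = 0)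
    (Jb₂ : S₂ → Type*) [∀ b, Countable (Jb₂ b)]
    (h₂ : ∀ b, Jb₂ b → C_c(UnitaryGroup.arch (↥(maximalRealSubfield L)) L (IsCMField.complexConj L) 2 J, ℂ))
    (hhl₂ : ∀ b (j : Jb₂ b) (k : ↥(UnitaryGroup.arch (↥(maximalRealSubfield L)) L (IsCMField.complexConj L) 2 J ⊓ unitaryGroupOfForm (conjMixed (↥(maximalRealSubfield L)) L (IsCMField.complexConj L)) 1)) (x : UnitaryGroup.arch (↥(maximalRealSubfield L)) L (IsCMField.complexConj L) 2 J), h₂ b j ((Subgroup.inclusion (inf_le_left : UnitaryGroup.arch (↥(maximalRealSubfield L)) L (IsCMField.complexConj L) 2 J ⊓ unitaryGroupOfForm (conjMixed (↥(maximalRealSubfield L)) L (IsCMField.complexConj L)) 1 ≤ UnitaryGroup.arch (↥(maximalRealSubfield L)) L (IsCMField.complexConj L) 2 J)) k * x) = χ k * h₂ b j x)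
    (hhr₂ : ∀ b (j : Jb₂ b) (k : ↥(UnitaryGroup.arch (↥(maximalRealSubfield L)) L (IsCMField.complexConj L) 2 J ⊓ unitaryGroupOfForm (conjMixed (↥(maximalRealSubfield L)) L (IsCMField.complexConj L)) 1)) (x : UnitaryGroup.arch (↥(maximalRealSubfield L)) L (IsCMField.complexConj L) 2 J), h₂ b j (x * (Subgroup.inclusion (inf_le_left : UnitaryGroup.arch (↥(maximalRealSubfield L)) L (IsCMField.complexConj L) 2 J ⊓ unitaryGroupOfForm (conjMixed (↥(maximalRealSubfield L)) L (IsCMField.complexConj L)) 1 ≤ UnitaryGroup.arch (↥(maximalRealSubfield L)) L (IsCMField.complexConj L) 2 J)) k) = χ k * h₂ b j x)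
    (s₂ : ∀ b, Jb₂ b → Ω₂ b → ℂ) (hs₂ : ∀ b j, MemLp (s₂ b j) ∞ (m₂ b))
    (hU₂ : ∀ b j, ∀ v ∈ LinearMap.eqLocus (P : (cmDatum L 2 J).L2 μ →ₗ[ℂ] (cmDatum L 2 J).L2 μ) LinearMap.id,
      ((V₂ b ∘ₗ (((Submodule.span ℂ (gen₂ b)).topologicalClosure).starProjection : (cmDatum L 2 J).L2 μ →L[ℂ] (cmDatum L 2 J).L2 μ).toLinearMap) (((((cmDatum L 2 J).rightRegular μ).restrict (archToAdelic (↥(maximalRealSubfield L)) L (IsCMField.complexConj L) 2 J)).integratedOperator (((cmDatum L 2 J).isUnitary_rightRegular μ).restrict _) (((cmDatum L 2 J).isStronglyContinuous_rightRegular_holds μ).restrict _ (continuous_archToAdelic (↥(maximalRealSubfield L)) L (IsCMField.complexConj L) 2 J)) νinf (h₂ b j) ∘L (((cmDatum L 2 J).rightRegular μ).restrict (finAdelicToAdelic (↥(maximalRealSubfield L)) L (IsCMField.complexConj L) 2 J)).integratedOperator (((cmDatum L 2 J).isUnitary_rightRegular μ).restrict _) (((cmDatum L 2 J).isStronglyContinuous_rightRegular_holds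 μ).restrict _ (continuous_finAdelicToAdelic (↥(maximalRealSubfield L)) L (IsCMField.complexConj L) 2 J)) νf e) v)).2 = ((hs₂ b j).toLp (s₂ b j) • ((V₂ b ∘ₗ (((Submodule.span ℂ (gen₂ b)).topologicalClosure).starProjection : (cmDatum L 2 J).L2 μ →L[ℂ] (cmDatum L 2 J).L2 μ).toLinearMap) v).2 : Lp (E₂ b) 2 (m₂ b)))
    (hline₂ : ∀ b (c : Jb₂ b → ℂ), m₂ b {x | ∀ j, s₂ b j x = c j} = 0)
    (hEis : (((cmDatum L 2 J).cuspidalSubspace μ 𝔓).toSubmoduleᗮ ⊓ ((((cmDatum L 2 J).rightRegular μ)).restrict Kad.subtype).invariants) ≤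
      ((⨆ b, (Submodule.span ℂ (gen₁ b)).topologicalClosure) ⊔ (⨆ b, (Submodule.span ℂ (gen₂ b)).topologicalClosure)).topologicalClosure) :
    FiniteDimensional ℂ ↥((residualSubspace (cmDatum L 2 J) μ 𝔓).toSubmodule ⊓
      ((((cmDatum L 2 J).rightRegular μ)).restrict ((finAdelicToAdelic (↥(maximalRealSubfield L)) L (IsCMField.complexConj L) 2 J).comp K'.subtype)).invariants ⊓
      ((((cmDatum L 2 J).rightRegular μ)).restrict ((archToAdelic (↥(maximalRealSubfield L)) L (IsCMField.complexConj L) 2 J).comp (Subgroup.inclusion (inf_le_left : UnitaryGroup.arch (↥(maximalRealSubfield L)) L (IsCMField.complexConj L) 2 J ⊓ unitaryGroupOfForm (conjMixed (↥(maximalRealSubfield L)) L (IsCMField.complexConj L)) 1 ≤ UnitaryGroup.arch (↥(maximalRealSubfield L)) L (IsCMField.complexConj L) 2 J)))).invariants) := by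
  have hχτ : ∀ k, χ k = ((1 : ↥(UnitaryGroup.arch (↥(maximalRealSubfield L)) L (IsCMField.complexConj L) 2 J ⊓ unitaryGroupOfForm (conjMixed (↥(maximalRealSubfield L)) L (IsCMField.complexConj L)) 1) →* ℂ) k)⁻¹ := fun k => by rw [hχ1, MonoidHom.one_apply, inv_one]
  have hτ : ∀ k, ‖(1 : ↥(UnitaryGroup.arch (↥(maximalRealSubfield L)) L (IsCMField.complexConj L) 2 J ⊓ unitaryGroupOfForm (conjMixed (↥(maximalRealSubfield L)) L (IsCMField.complexConj L)) 1) →* ℂ) k‖ = 1 := fun k => by rw [MonoidHom.one_apply, norm_one]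
  haveI := residual_kType_finiteDimensional_letterFree_of_twoBlockFamilies J μ νinf νf μK χ e hJc hJ2 hJw (1 : ↥(UnitaryGroup.arch (↥(maximalRealSubfield L)) L (IsCMField.complexConj L) 2 J ⊓ unitaryGroupOfForm (conjMixed (↥(maximalRealSubfield L)) L (IsCMField.complexConj L)) 1) →* ℂ) hχτ hτ
    K' hK'o he0 he1 heK hestar P hPdef 𝔓 gen₁ m₁ V₁ hV₁ Jb₁ h₁ hhl₁ hhr₁ s₁ hs₁ hU₁ hline₁ gen₂ m₂ V₂ hV₂ Jb₂ h₂ hhl₂ hhr₂ s₂ hs₂ hU₂ hline₂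
    ((eisOne_split_le_eis J μ K' 𝔓 Kad hKad).trans hEis)
  exact Submodule.finiteDimensional_of_le (inf_le_inf le_rfl (invariants_le_iInf_eigenspace_one J μ))

end Witness

end Summit.HodgeConjecture.HodgeConjecture.Cruxes.H413.K2E1ResidualKTypeFiniteOfTwoBlockFamilies

end
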